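import Summits.QuantumFields.QCD.Theses.SpectralDefectExtinction
import Summits.QuantumFields.QCD.Theorems.SpectralDefectExtinctionExtinctionBuildsQCDStubSignPolyApprox
import Summits.QuantumFields.QCD.Theorems.SpectralDefectExtinctionExtinctionBuildsQCDStubSignCocycleLocal
import Summits.QuantumFields.QCD.Theorems.SpectralDefectExtinctionExtinctionBuildsQCDStubFermiProjectorScreeningPointwise
import Literature.MathematicalPhysics.QuantumLattice.DuhamelTwoPoint
import Literature.MathematicalPhysics.QuantumLattice.MobilityGap
import Literature.MathematicalPhysics.QuantumLattice.OverlapLocality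
import Mathlib.Analysis.Matrix.HermitianFunctionalCalculus
import Mathlib.Data.Real.Sign

/-!
# Stub S1 `stub_kinematicSignSplit` of line `determinant-tilt` (crux `SpectralDefectExtinction.ExtinctionBuildsQCD`,
# item stmt-QuantumFields-18064) — the sign matrix of `H_W = Γ₅ D_W(U, m₀, 1)` is a kinematically local part plus a
# window-mode part: `Σ_{p,q} ‖sgn(H)((x,p),(y,q))‖ ≤ (C₁/t) e^{−c₁ t |x−y|₁} + 2 Σ_{p,q} Σ_{|λ_i|<t} ‖u_i(x,p)‖ ‖u_i(y,q)‖`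

§1 re-derives the Chebyshev needle of the landed `WeylWindow.stub_signPolyApprox` (p97539, same construction) WITH the
bound its statement hides (`|p| ≤ 1` on `[−9, 9]`: `p` is the affine renormalisation of a monotone antiderivative with
`p(±9) = ±1`), in `Real.sign` currency.  §2 is the abstract split for a Hermitian matrix (`f(H) = U diag(f∘λ) U⋆`,
`Matrix.IsHermitian.cfc_eq`; a polynomial of degree below the range-one distance of `x, y` has vanishing `(x, y)` entry;
rows of a unitary are unit vectors).  §3 is the registered stub (range one `WeylWindow.hW_apply_eq_zero_of_far`,
spectrum in `[−9, 9]` `WeylWindow.abs_eigenvalue_hW_le_nine`, needle of degree `≤ |x−y|₁ − 1`; `c₁ = 1/16`).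
References (prose): Hernández–Jansen–Lüscher, Nucl. Phys. B 552 (1999) §2.2; Bhatia, Matrix Analysis, III.
-/

noncomputable section

namespace Summit.QuantumFields.QCD.Cruxes.ExtinctionBuildsQCD.DeterminantTilt

open scoped BigOperators Topology Classical MeasureTheory Matrix ENNReal
open Filter MeasureTheory Matrix
open Literature.MathematicalPhysics.QuantumLattice Literature.MathematicalPhysics.QuantumFieldTheory
  Literature.Probability.LatticeModels
open Summit.QuantumFields.QCD.Theses.SpectralDefectExtinction
open Summit.QuantumFields.QCD.Cruxes.ExtinctionBuildsQCD.WeylWindow (hW_apply_eq_zero_of_far abs_eigenvalue_hW_le_nine)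

/-! ## §1 The bounded Chebyshev needle (adapted from the landed `WeylWindow.stub_signPolyApprox`) -/

section Needle

open Polynomial Real

/-- Every real polynomial has a formal antiderivative of degree at most one more. -/
private lemma exists_antider (K : ℝ[X]) : ∃ Q : ℝ[X], derivative Q = K ∧ Q.natDegree ≤ K.natDegree + 1 := by
  refine ⟨∑ i ∈ K.support, C (K.coeff i / (i + 1)) * X ^ (i + 1), ?_, ?_⟩
  · rw [derivative_sum]
    conv_rhs => rw [K.as_sum_support_C_mul_X_pow]
    refine Finset.sum_congr rfl fun i _ => ?_
    rw [derivative_C_mul_X_pow, Nat.add_sub_cancel, Nat.cast_succ, div_mul_cancel₀ _ (by positivity)]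
  · refine natDegree_sum_le_of_forall_le _ _ fun i hi => (natDegree_C_mul_X_pow_le _ _).trans ?_
    have := le_natDegree_of_mem_supp i hi
    omega

/-- Mean value upper bound for a polynomial from an upper bound on its derivative. -/
private lemma eval_sub_le_mul_sub (Q : ℝ[X]) {a b M : ℝ} (hab : a ≤ b)
    (h : ∀ s, a ≤ s → s ≤ b → Q.derivative.eval s ≤ M) : Q.eval b - Q.eval a ≤ M * (b - a) := by
  refine (convex_Icc a b).image_sub_le_mul_sub_of_deriv_le (f := fun x => Q.eval x) Q.continuousOn
    Q.differentiableOn (C := M) ?_ a (Set.left_mem_Icc.2 hab) b (Set.right_mem_Icc.2 hab) hab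
  intro x hx
  rw [Polynomial.deriv]
  exact h x (interior_subset hx).1 (interior_subset hx).2

/-- If `cosh θ ≤ y` with `θ ≥ 0` then `exp (n θ) / 2 ≤ T_n(y)`. -/
private lemma exp_le_eval_T {θ y : ℝ} (hθ : 0 ≤ θ) (hy : Real.cosh θ ≤ y) (n : ℕ) :
    Real.exp (n * θ) / 2 ≤ (Chebyshev.T ℝ n).eval y := by
  have h1 : 1 ≤ y := (Real.one_le_cosh θ).trans hy
  rw [← Real.cosh_arcosh h1] at hy ⊢; rw [Chebyshev.T_real_cosh]
  have hθ' : θ ≤ arcosh y := by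
    have := Real.cosh_le_cosh.1 hy
    rwa [abs_of_nonneg hθ, abs_of_nonneg (arcosh_nonneg h1)] at this
  have hn : (n : ℝ) * θ ≤ n * arcosh y := mul_le_mul_of_nonneg_left hθ' (Nat.cast_nonneg n)
  have h0 : 0 ≤ (n : ℝ) * θ := by positivity
  calc Real.exp (n * θ) / 2 ≤ Real.cosh (n * θ) := by rw [Real.cosh_eq]; linarith [Real.exp_nonneg (-(n * θ))]
    _ ≤ Real.cosh (n * arcosh y) := by rw [Real.cosh_le_cosh, abs_of_nonneg h0, abs_of_nonneg (h0.trans hn)]; exact hn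
    _ = Real.cosh (((n : ℤ) : ℝ) * arcosh y) := by norm_cast

/-- `cosh (t/8) ≤ 1 + t²/54` for `0 < t ≤ 1`. -/
private lemma cosh_eighth_le {t : ℝ} (ht0 : 0 < t) (ht1 : t ≤ 1) : Real.cosh (t / 8) ≤ 1 + t ^ 2 / 54 := by
  have h1 : Real.cosh (t / 8) ≤ Real.exp ((t / 8) ^ 2 / 2) := Real.cosh_le_exp_half_sq _
  have hsmall : |(t / 8) ^ 2 / 2| ≤ 1 := by rw [abs_of_nonneg (by positivity)]; nlinarith
  have h2 := Real.abs_exp_sub_one_le hsmall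
  rw [abs_of_nonneg (by positivity : (0:ℝ) ≤ (t / 8) ^ 2 / 2)] at h2
  have h3 := (le_abs_self _).trans h2
  nlinarith

/-- The inner quadratic `φ_t(s) = (81 + t² - 2 s²)/(81 - t²)` maps `t² ≤ s² ≤ 81` into `[-1, 1]`. -/
private lemma abs_phi_le_one {t s : ℝ} (ht0 : 0 < t) (ht1 : t ≤ 1) (h1 : t ^ 2 ≤ s ^ 2) (h2 : s ^ 2 ≤ 81) :
    |(81 + t ^ 2 - 2 * s ^ 2) / (81 - t ^ 2)| ≤ 1 := by
  have hw : 0 < 81 - t ^ 2 := by nlinarith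
  rw [abs_le]
  exact ⟨by rw [le_div_iff₀ hw]; nlinarith, by rw [div_le_one hw]; nlinarith⟩

/-- The inner quadratic `φ_t` is at least `cosh (t/8)` on `s² ≤ t²/4`. -/
private lemma cosh_le_phi {t s : ℝ} (ht0 : 0 < t) (ht1 : t ≤ 1) (hs : s ^ 2 ≤ t ^ 2 / 4) :
    Real.cosh (t / 8) ≤ (81 + t ^ 2 - 2 * s ^ 2) / (81 - t ^ 2) := by
  have hw : 0 < 81 - t ^ 2 := by nlinarith
  refine (cosh_eighth_le ht0 ht1).trans ?_; rw [le_div_iff₀ hw]; nlinarith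

/-- The needle kernel `K = (T_n ∘ φ_t)²`: degree `≤ 4n`, nonnegative, at most `1` on `t² ≤ s² ≤ 81`, and
exponentially large on `s² ≤ t²/4`. -/
private lemma exists_kernel {t : ℝ} (ht0 : 0 < t) (ht1 : t ≤ 1) (n : ℕ) :
    ∃ K : ℝ[X], K.natDegree ≤ 4 * n ∧ (∀ s, 0 ≤ K.eval s) ∧ (∀ s, t ^ 2 ≤ s ^ 2 → s ^ 2 ≤ 81 → K.eval s ≤ 1) ∧
      (∀ s, s ^ 2 ≤ t ^ 2 / 4 → Real.exp (n * t / 4) / 4 ≤ K.eval s) := by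
  obtain ⟨L, hLev, hLdeg⟩ : ∃ L : ℝ[X], (∀ s, L.eval s = (81 + t ^ 2 - 2 * s ^ 2) / (81 - t ^ 2)) ∧ L.natDegree ≤ 2 :=
    ⟨C ((81 + t ^ 2) / (81 - t ^ 2)) - C (2 / (81 - t ^ 2)) * X ^ 2,
      fun s => by simp only [eval_sub, eval_mul, eval_C, eval_pow, eval_X]; ring,
      (natDegree_sub_le _ _).trans (max_le (by simp) (natDegree_C_mul_X_pow_le _ _))⟩
  have hev : ∀ s, (((Chebyshev.T ℝ n).comp L) ^ 2).eval s =
      ((Chebyshev.T ℝ n).eval ((81 + t ^ 2 - 2 * s ^ 2) / (81 - t ^ 2))) ^ 2 := fun s => by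
    simp only [eval_pow, eval_comp, hLev]
  refine ⟨((Chebyshev.T ℝ n).comp L) ^ 2, ?_, fun s => ?_, fun s h1 h2 => ?_, fun s hs => ?_⟩
  · have hN : ((Chebyshev.T ℝ n).comp L).natDegree ≤ n * 2 :=
      natDegree_comp_le.trans (by rw [Chebyshev.natDegree_T, Int.natAbs_natCast]; exact Nat.mul_le_mul_left _ hLdeg)
    exact natDegree_pow_le.trans (by omega)
  · rw [hev]; positivity
  · rw [hev, sq_le_one_iff_abs_le_one]
    exact Chebyshev.abs_eval_T_real_le_one n (abs_phi_le_one ht0 ht1 h1 h2)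
  · have hT := exp_le_eval_T (by positivity : (0:ℝ) ≤ t / 8) (cosh_le_phi ht0 ht1 hs) n
    have h0 : 0 ≤ Real.exp (n * (t / 8)) / 2 := by positivity
    rw [hev]
    calc Real.exp (n * t / 4) / 4 = (Real.exp (n * (t / 8)) / 2) ^ 2 := by
          rw [div_pow, sq (Real.exp _), ← Real.exp_add]
          exact congrArg₂ (· / ·) (congrArg Real.exp (by ring)) (by norm_num)
      _ ≤ _ := pow_le_pow_left₀ h0 hT 2

/-- The antiderivative `Q` of the kernel: degree `≤ 4n+1`, monotone, total increase over `[-9, 9]` at least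
`t e^{nt/4}/8`, but increase at most `9` over `[x, 9]` for `x ≥ t` and over `[-9, x]` for `x ≤ -t`. -/
private lemma exists_prim {t : ℝ} (ht0 : 0 < t) (ht1 : t ≤ 1) (n : ℕ) :
    ∃ Q : ℝ[X], Q.natDegree ≤ 4 * n + 1 ∧ (∀ a b : ℝ, a ≤ b → Q.eval a ≤ Q.eval b) ∧
      t * Real.exp (n * t / 4) / 8 ≤ Q.eval 9 - Q.eval (-9) ∧
      (∀ x, t ≤ x → x ≤ 9 → Q.eval 9 - Q.eval x ≤ 9) ∧ (∀ x, -9 ≤ x → x ≤ -t → Q.eval x - Q.eval (-9) ≤ 9) := by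
  obtain ⟨K, hKdeg, hK0, hK1, hK2⟩ := exists_kernel ht0 ht1 n
  obtain ⟨Q, hQK, hQdeg⟩ := exists_antider K
  have hmono : ∀ a b : ℝ, a ≤ b → Q.eval a ≤ Q.eval b := fun a b hab => by
    refine monotone_of_deriv_nonneg Q.differentiable (fun x => ?_) hab
    rw [Polynomial.deriv, hQK]
    exact hK0 x
  refine ⟨Q, hQdeg.trans (by omega), hmono, ?_, fun x hx1 hx2 => ?_, fun x hx1 hx2 => ?_⟩
  · have h := eval_sub_le_mul_sub (-Q) (a := 0) (b := t / 2) (M := -(Real.exp (n * t / 4) / 4)) (by positivity)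
      (fun s hs1 hs2 => by rw [derivative_neg, eval_neg, hQK, neg_le_neg_iff]; exact hK2 s (by nlinarith))
    rw [eval_neg, eval_neg] at h
    have h1 := hmono _ _ (show t / 2 ≤ 9 by linarith)
    have h2 := hmono _ _ (show (-9 : ℝ) ≤ 0 by norm_num)
    linarith
  · linarith [eval_sub_le_mul_sub Q (M := 1) hx2 (fun s hs1 hs2 => by rw [hQK]; exact hK1 s (by nlinarith) (by nlinarith))]
  · linarith [eval_sub_le_mul_sub Q (M := 1) hx1 (fun s hs1 hs2 => by rw [hQK]; exact hK1 s (by nlinarith) (by nlinarith))]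

/-- Converting the gap lower bound into the final error bound. -/
private lemma abs_div_le {t Δ y : ℝ} (ht0 : 0 < t) (n : ℕ) (hgap : t * Real.exp (n * t / 4) / 8 ≤ Δ) (hy0 : 0 ≤ y)
    (hy9 : y ≤ 9) : |2 * y / Δ| ≤ 144 / t * Real.exp (-(n * t / 4)) := by
  have he : 0 < Real.exp (n * t / 4) := Real.exp_pos _
  have hΔ : 0 < Δ := lt_of_lt_of_le (by positivity) hgap
  rw [abs_of_nonneg (by positivity), Real.exp_neg, ← div_eq_mul_inv, div_div, div_le_div_iff₀ hΔ (by positivity)]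
  nlinarith [mul_le_mul_of_nonneg_right hgap (by positivity : (0:ℝ) ≤ 2 * y),
    mul_le_mul_of_nonneg_left hy9 (by positivity : (0:ℝ) ≤ t * Real.exp (n * t / 4))]

/-- The bounded needle polynomial at Chebyshev order `n`: degree `≤ 4n+1`, within `(144/t) e^{-nt/4}` of `1` on
`[t, 9]` and of `-1` on `[-9, -t]`, and — the bound hidden by the landed statement — of modulus `≤ 1` on `[-9, 9]`
(it is `(2Q − Q(9) − Q(−9))/(Q(9) − Q(−9))` for a monotone `Q`). -/
private lemma exists_needle {t : ℝ} (ht0 : 0 < t) (ht1 : t ≤ 1) (n : ℕ) :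
    ∃ p : ℝ[X], p.natDegree ≤ 4 * n + 1 ∧
      (∀ x, t ≤ x → x ≤ 9 → |p.eval x - 1| ≤ 144 / t * Real.exp (-(n * t / 4))) ∧
      (∀ x, -9 ≤ x → x ≤ -t → |p.eval x + 1| ≤ 144 / t * Real.exp (-(n * t / 4))) ∧
      (∀ x, -9 ≤ x → x ≤ 9 → |p.eval x| ≤ 1) := by
  obtain ⟨Q, hQdeg, hmono, hgap, hright, hleft⟩ := exists_prim ht0 ht1 n
  have hΔ : 0 < Q.eval 9 - Q.eval (-9) := lt_of_lt_of_le (by positivity) hgap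
  have hev : ∀ x, (C (2 / (Q.eval 9 - Q.eval (-9))) * Q - C ((Q.eval 9 + Q.eval (-9)) / (Q.eval 9 - Q.eval (-9)))).eval x =
      (2 * Q.eval x - (Q.eval 9 + Q.eval (-9))) / (Q.eval 9 - Q.eval (-9)) := fun x => by
    simp only [eval_sub, eval_mul, eval_C]
    field_simp
  refine ⟨C (2 / (Q.eval 9 - Q.eval (-9))) * Q - C ((Q.eval 9 + Q.eval (-9)) / (Q.eval 9 - Q.eval (-9))), ?_,
    fun x hx1 hx2 => ?_, fun x hx1 hx2 => ?_, fun x hx1 hx2 => ?_⟩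
  · rw [natDegree_sub_C]
    exact (natDegree_C_mul_le _ _).trans hQdeg
  · rw [hev, show (2 * Q.eval x - (Q.eval 9 + Q.eval (-9))) / (Q.eval 9 - Q.eval (-9)) - 1 =
      -(2 * (Q.eval 9 - Q.eval x) / (Q.eval 9 - Q.eval (-9))) by field_simp; ring, abs_neg]
    exact abs_div_le ht0 n hgap (sub_nonneg.2 (hmono _ _ hx2)) (hright x hx1 hx2)
  · rw [hev, show (2 * Q.eval x - (Q.eval 9 + Q.eval (-9))) / (Q.eval 9 - Q.eval (-9)) + 1 =
      2 * (Q.eval x - Q.eval (-9)) / (Q.eval 9 - Q.eval (-9)) by field_simp; ring]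
    exact abs_div_le ht0 n hgap (sub_nonneg.2 (hmono _ _ hx1)) (hleft x hx1 hx2)
  · rw [hev, abs_div, abs_of_pos hΔ, div_le_one hΔ, abs_le]
    constructor <;> linarith [hmono _ _ hx1, hmono _ _ hx2]

/-- **Bounded sign approximation** (the needle of the landed `WeylWindow.stub_signPolyApprox` at Chebyshev order `m`, with
its hidden bound `|p| ≤ 1` on `[-9, 9]` re-exported, in `Real.sign` currency): for `t ∈ (0, 1]` some real polynomial `p` of
degree `≤ 4m + 1` has `|sgn x − p(x)| ≤ (144/t) e^{−mt/4}` for `t ≤ |x| ≤ 9` and `|sgn x − p(x)| ≤ 2` for `|x| ≤ 9`. -/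
theorem signPolyApprox_bounded {t : ℝ} (ht0 : 0 < t) (ht1 : t ≤ 1) (m : ℕ) :
    ∃ p : ℝ[X], p.natDegree ≤ 4 * m + 1 ∧
      (∀ x : ℝ, t ≤ |x| → |x| ≤ 9 → |Real.sign x - p.eval x| ≤ 144 / t * Real.exp (-(m * t / 4))) ∧
      (∀ x : ℝ, |x| ≤ 9 → |Real.sign x - p.eval x| ≤ 2) := by
  obtain ⟨p, hdeg, h1, h2, h3⟩ := exists_needle ht0 ht1 m
  refine ⟨p, hdeg, fun x hx1 hx2 => ?_, fun x hx => ?_⟩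
  · have hx0 : x ≠ 0 := fun h => by rw [h, abs_zero] at hx1; exact absurd hx1 (not_le.2 ht0)
    rcases hx0.lt_or_gt with hx | hx
    · rw [abs_of_neg hx] at hx1 hx2
      rw [Real.sign_of_neg hx, show (-1 : ℝ) - p.eval x = -(p.eval x + 1) by ring, abs_neg]
      exact h2 x (by linarith) (by linarith)
    · rw [abs_of_pos hx] at hx1 hx2
      rw [Real.sign_of_pos hx, show (1 : ℝ) - p.eval x = -(p.eval x - 1) by ring, abs_neg]
      exact h1 x hx1 hx2
  · have hs : |Real.sign x| ≤ 1 := by rcases Real.sign_apply_eq x with h | h | h <;> rw [h] <;> norm_num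
    exact (abs_sub _ _).trans (by linarith [h3 x (abs_le.1 hx).1 (abs_le.1 hx).2])

end Needle

/-! ## §2 The abstract split for a Hermitian matrix -/

section SignSplit

open Finset

variable {ι : Type*} [Fintype ι] [DecidableEq ι]

/-- The Hermitian functional calculus entrywise: `f(H) x y = ∑ᵢ U x i · f(λᵢ) · conj (U y i)`
(`Matrix.IsHermitian.cfc_eq`). -/
private theorem cfc_apply_eq_sum {H : Matrix ι ι ℂ} (hH : H.IsHermitian) (f : ℝ → ℝ) (x y : ι) :
    (cfc f H) x y = ∑ i, (hH.eigenvectorUnitary : Matrix ι ι ℂ) x i * (f (hH.eigenvalues i) : ℂ) *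
      star ((hH.eigenvectorUnitary : Matrix ι ι ℂ) y i) := by
  rw [hH.cfc_eq_conj_diagonal, mul_apply]
  refine sum_congr rfl fun i _ => ?_
  rw [mul_diagonal, star_eq_conjTranspose, conjTranspose_apply]

/-- Powers of a range-one matrix: `(H ^ n) p q = 0` whenever `n < d p q`, for a pseudo-distance `d` vanishing on
the diagonal and satisfying the triangle inequality (adapted from the landed `WeylWindow.stub_arctanKernelLocality`). -/
private theorem pow_apply_eq_zero_of_lt (d : ι → ι → ℕ) (hd0 : ∀ p, d p p = 0)
    (htri : ∀ p q r, d p r ≤ d p q + d q r) (H : Matrix ι ι ℂ) (hH : ∀ p q, 1 < d p q → H p q = 0) :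
    ∀ (n : ℕ) (p q : ι), n < d p q → (H ^ n) p q = 0 := by
  intro n
  induction n with
  | zero =>
    intro p q hpq
    have hne : p ≠ q := fun h => by rw [h, hd0] at hpq; exact Nat.lt_irrefl 0 hpq
    rw [pow_zero, Matrix.one_apply_ne hne]
  | succ n ih =>
    intro p q hpq
    rw [pow_succ, Matrix.mul_apply]
    refine sum_eq_zero fun r _ => ?_
    by_cases hrq : 1 < d r q
    · rw [hH r q hrq, mul_zero]
    · rw [ih p r (by have := htri p r q; omega), zero_mul]

/-- A real polynomial of degree `< d x y` in a range-one Hermitian matrix has vanishing `(x, y)` entry, read in the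
eigenbasis: `∑ᵢ U x i · q(λᵢ) · conj (U y i) = 0`. -/
private theorem sum_eval_eigenvalues_eq_zero {H : Matrix ι ι ℂ} (hH : H.IsHermitian) (d : ι → ι → ℕ)
    (hd0 : ∀ p, d p p = 0) (htri : ∀ p q r, d p r ≤ d p q + d q r) (hrange : ∀ p q, 1 < d p q → H p q = 0)
    (q : Polynomial ℝ) {x y : ι} (hq : q.natDegree < d x y) :
    ∑ i, (hH.eigenvectorUnitary : Matrix ι ι ℂ) x i * ((q.eval (hH.eigenvalues i) : ℝ) : ℂ) *
      star ((hH.eigenvectorUnitary : Matrix ι ι ℂ) y i) = 0 := by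
  have h : (Polynomial.aeval H q) x y = 0 := by
    rw [Polynomial.aeval_eq_sum_range, Matrix.sum_apply]
    refine sum_eq_zero fun k hk => ?_
    rw [Matrix.smul_apply, pow_apply_eq_zero_of_lt d hd0 htri H hrange k x y
      (lt_of_le_of_lt (Nat.lt_succ_iff.1 (mem_range.1 hk)) hq), smul_zero]
  rwa [← cfc_polynomial q H hH.isSelfAdjoint, cfc_apply_eq_sum hH] at h

/-- **Cauchy–Schwarz split of a spectral sum.** For a unitary `V` and reals `aᵢ` with `|aᵢ| ≤ η` off a window `P` and
`|aᵢ| ≤ 2` everywhere, `‖∑ᵢ V x i · aᵢ · conj (V y i)‖ ≤ η + 2 Σ_{P i} ‖V x i‖ ‖V y i‖` (rows of `V` are unit vectors). -/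
private theorem norm_sum_mul_le {V : Matrix ι ι ℂ} (hV : V ∈ unitary (Matrix ι ι ℂ)) (x y : ι) (a : ι → ℝ)
    (P : ι → Prop) [DecidablePred P] {η : ℝ} (hη : 0 ≤ η) (h1 : ∀ i, ¬ P i → |a i| ≤ η) (h2 : ∀ i, |a i| ≤ 2) :
    ‖∑ i, V x i * (a i : ℂ) * star (V y i)‖ ≤ η + 2 * ∑ i ∈ univ.filter P, ‖V x i‖ * ‖V y i‖ := by
  have hw0 : ∀ i, 0 ≤ ‖V x i‖ * ‖V y i‖ := fun i => mul_nonneg (norm_nonneg _) (norm_nonneg _)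
  have hw1 : ∑ i, ‖V x i‖ * ‖V y i‖ ≤ 1 :=
    calc ∑ i, ‖V x i‖ * ‖V y i‖ ≤ ∑ i, (‖V x i‖ ^ 2 + ‖V y i‖ ^ 2) / 2 :=
          sum_le_sum fun i _ => by nlinarith [two_mul_le_add_sq ‖V x i‖ ‖V y i‖]
      _ = 1 := by
          rw [← sum_div, sum_add_distrib, Matrix.sum_norm_sq_row_eq_one hV x, Matrix.sum_norm_sq_row_eq_one hV y]
          norm_num
  have hterm : ∀ i, ‖V x i * (a i : ℂ) * star (V y i)‖ = |a i| * (‖V x i‖ * ‖V y i‖) := fun i => by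
    rw [norm_mul, norm_mul, norm_star, Complex.norm_real, Real.norm_eq_abs]; ring
  calc ‖∑ i, V x i * (a i : ℂ) * star (V y i)‖ ≤ ∑ i, |a i| * (‖V x i‖ * ‖V y i‖) :=
        (norm_sum_le _ _).trans (le_of_eq (sum_congr rfl fun i _ => hterm i))
    _ = ∑ i ∈ univ.filter P, |a i| * (‖V x i‖ * ‖V y i‖) + ∑ i ∈ univ.filter (fun i => ¬ P i), |a i| * (‖V x i‖ * ‖V y i‖) :=
        (sum_filter_add_sum_filter_not _ _ _).symm
    _ ≤ ∑ i ∈ univ.filter P, 2 * (‖V x i‖ * ‖V y i‖) + ∑ i ∈ univ.filter (fun i => ¬ P i), η * (‖V x i‖ * ‖V y i‖) :=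
        add_le_add (sum_le_sum fun i _ => mul_le_mul_of_nonneg_right (h2 i) (hw0 i))
          (sum_le_sum fun i hi => mul_le_mul_of_nonneg_right (h1 i (mem_filter.1 hi).2) (hw0 i))
    _ ≤ 2 * ∑ i ∈ univ.filter P, ‖V x i‖ * ‖V y i‖ + η * 1 := by
        rw [← mul_sum, ← mul_sum]
        refine add_le_add le_rfl (mul_le_mul_of_nonneg_left ?_ hη)
        exact (sum_le_sum_of_subset_of_nonneg (filter_subset _ _) fun i _ _ => hw0 i).trans hw1
    _ = η + 2 * ∑ i ∈ univ.filter P, ‖V x i‖ * ‖V y i‖ := by rw [mul_one, add_comm]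

/-- **Abstract sign split.** Let `H` be Hermitian with eigenpairs `(λᵢ, uᵢ)` and let reals `cᵢ` contribute nothing to
the entry `(x, y)` in the eigenbasis (`∑ᵢ U x i · cᵢ · conj (U y i) = 0` — e.g. `cᵢ = p(λᵢ)` for a polynomial `p` of
degree below the range-one distance of `x, y`).  If `|sgn λᵢ − cᵢ| ≤ η` off the window (`t ≤ |λᵢ|`) and `≤ 2` always,
then `‖sgn(H) x y‖ ≤ η + 2 Σ_{|λᵢ|<t} ‖uᵢ x‖ ‖uᵢ y‖`. -/
private theorem norm_cfc_sign_apply_le {H : Matrix ι ι ℂ} (hH : H.IsHermitian) (x y : ι) (c : ι → ℝ)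
    (hc : ∑ i, (hH.eigenvectorUnitary : Matrix ι ι ℂ) x i * (c i : ℂ) *
      star ((hH.eigenvectorUnitary : Matrix ι ι ℂ) y i) = 0)
    {t η : ℝ} (hη : 0 ≤ η) (h1 : ∀ i, t ≤ |hH.eigenvalues i| → |Real.sign (hH.eigenvalues i) - c i| ≤ η)
    (h2 : ∀ i, |Real.sign (hH.eigenvalues i) - c i| ≤ 2) :
    ‖(cfc Real.sign H) x y‖ ≤ η + 2 * ∑ i ∈ univ.filter (fun i => |hH.eigenvalues i| < t),
        ‖(hH.eigenvectorBasis i) x‖ * ‖(hH.eigenvectorBasis i) y‖ := by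
  -- the entry as a spectral sum against `sgn λᵢ − cᵢ`
  have key : (cfc Real.sign H) x y = ∑ i, (hH.eigenvectorUnitary : Matrix ι ι ℂ) x i *
      ((Real.sign (hH.eigenvalues i) - c i : ℝ) : ℂ) * star ((hH.eigenvectorUnitary : Matrix ι ι ℂ) y i) := by
    rw [← sub_zero ((cfc Real.sign H) x y), ← hc, cfc_apply_eq_sum hH, ← sum_sub_distrib]
    refine sum_congr rfl fun i _ => ?_
    push_cast
    ring
  rw [key]
  refine (norm_sum_mul_le hH.eigenvectorUnitary.prop x y _ (fun i => |hH.eigenvalues i| < t) hη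
    (fun i hi => h1 i (not_lt.1 hi)) h2).trans (le_of_eq ?_)
  simp only [Matrix.IsHermitian.eigenvectorUnitary_apply]

end SignSplit

/-! ## §3 The registered stub -/

/-- **Stub S1 (`stub_kinematicSignSplit`) — THE SIGN MATRIX SPLITS into a kinematically local part and a window-mode part
(DETERMINISTIC; typed by the K-worker of cycle 1 as `KinematicSignSplit`).** There are absolute `c₁, C₁ > 0` (here
`c₁ = 1/16`, `C₁ = 144 (144 e^{5/16} + 1)`) such that for every torus side `T`, every `SU(3)` field `U`, `|m₀| ≤ 1`, every level `t ∈ (0,1]`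
and all sites `x, y`, with `H = Γ₅D_W(U, m₀, 1)` (Hermitian — the hypothesis `hH` is always met, `WeylWindow.hW_isHermitian` —
range one, spectrum in `[−9,9]`) and `(λ_i, u_i)` its eigenpairs (`hH.eigenvalues`, `hH.eigenvectorBasis`):
`Σ_{p,q}‖sgn(H)((x,p),(y,q))‖ ≤ (C₁/t)·e^{−c₁ t |x−y|₁} + 2 Σ_{p,q} Σ_{|λ_i|<t} ‖u_i(x,p)‖‖u_i(y,q)‖`.
Proof: per entry, the bounded Chebyshev needle `p` of order `m = ⌊(|x−y|₁ − 2)/4⌋`, degree `≤ |x−y|₁ − 1`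
(`signPolyApprox_bounded`: `|sgn − p| ≤ (144/t)e^{−mt/4} ≤ (144 e^{5/16}/t)e^{−t|x−y|₁/16}` off `(−t,t)`, `≤ 2` on `[−9,9]`),
`p(H)(x,y) = 0` by range one (`WeylWindow.hW_apply_eq_zero_of_far`), `f(H) = U diag(f∘λ) U⋆` (`Matrix.IsHermitian.cfc_eq`),
so `sgn(H)(x,y) = Σ_i (sgn λ_i − p(λ_i)) u_i(x) conj(u_i(y))`, plus `Σ_i‖u_i(x,p)‖‖u_i(y,q)‖ ≤ 1`; at `|x−y|₁ ≤ 1` the entry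
bound `‖sgn(H)(·,·)‖ ≤ 1` suffices; then sum the `144` colour–spin pairs.  USE: the off-window half of K at the kinematic
rate, with NO Combes–Thomas and NO fractional moment. [HernandezJansenLuscher1999 §2.2; Bhatia, Matrix Analysis III] -/
theorem stub_kinematicSignSplit :
    (∃ c₁ C₁ : ℝ, 0 < c₁ ∧ 0 < C₁ ∧ ∀ (T : ℕ) [NeZero T] (U : GaugeConfig 4 T SU3) (m₀ : ℝ), |m₀| ≤ 1 →
      ∀ (hH : (spinorLift gammaFive * wilsonDirac (fundamentalRep (Fin 3)) U m₀ 1 :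
          Matrix (TorusSite 4 T × Fin 3 × Fin 4) (TorusSite 4 T × Fin 3 × Fin 4) ℂ).IsHermitian)
        (t : ℝ), 0 < t → t ≤ 1 → ∀ x y : TorusSite 4 T,
        ∑ p : Fin 3 × Fin 4, ∑ q : Fin 3 × Fin 4,
            ‖(cfc Real.sign (spinorLift gammaFive * wilsonDirac (fundamentalRep (Fin 3)) U m₀ 1) :
              Matrix (TorusSite 4 T × Fin 3 × Fin 4) (TorusSite 4 T × Fin 3 × Fin 4) ℂ) (x, p) (y, q)‖ ≤
          C₁ / t * Real.exp (-(c₁ * t * (torusTaxiDist x y : ℝ))) +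
            2 * ∑ p : Fin 3 × Fin 4, ∑ q : Fin 3 × Fin 4,
              ∑ i ∈ Finset.univ.filter (fun i => |hH.eigenvalues i| < t),
                ‖(hH.eigenvectorBasis i) (x, p)‖ * ‖(hH.eigenvectorBasis i) (y, q)‖) := by
  refine ⟨1 / 16, 144 * (144 * Real.exp (5 / 16) + 1), by norm_num, by positivity, ?_⟩
  intro T _ U m₀ hm₀ hH t ht0 ht1 x y
  -- the per-entry kinematic bound `B`
  obtain ⟨B, hB⟩ : ∃ B : ℝ, B = (144 * Real.exp (5 / 16) + 1) / t * Real.exp (-(1 / 16 * t * (torusTaxiDist x y : ℝ))) :=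
    ⟨_, rfl⟩
  have hE := Real.exp_pos (-(1 / 16 * t * (torusTaxiDist x y : ℝ)))
  have h1e : (1 : ℝ) ≤ Real.exp (5 / 16) := Real.one_le_exp (by norm_num)
  have h9 := abs_eigenvalue_hW_le_nine U m₀ hm₀ hH
  have hsum : ∀ f : Fin 3 × Fin 4 → Fin 3 × Fin 4 → ℝ,
      ∑ p : Fin 3 × Fin 4, ∑ q : Fin 3 × Fin 4, (B + 2 * f p q) = 144 * B + 2 * ∑ p, ∑ q, f p q := by
    intro f
    simp only [Finset.sum_add_distrib, Finset.sum_const, Finset.card_univ, Fintype.card_prod, Fintype.card_fin,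
      nsmul_eq_mul, ← Finset.mul_sum]
    push_cast
    ring
  calc _ ≤ ∑ p : Fin 3 × Fin 4, ∑ q : Fin 3 × Fin 4, (B + 2 * ∑ i ∈ Finset.univ.filter (fun i => |hH.eigenvalues i| < t),
          ‖(hH.eigenvectorBasis i) (x, p)‖ * ‖(hH.eigenvectorBasis i) (y, q)‖) := by
        gcongr with p _ q _
        rcases le_or_gt (torusTaxiDist x y) 1 with hd | hd
        · -- sites at taxi distance `≤ 1`: `‖sgn(H)(·,·)‖ ≤ 1 ≤ B` (`cᵢ = 0`, no polynomial needed)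
          have h1B : (1 : ℝ) ≤ B := by
            have hd' : (torusTaxiDist x y : ℝ) ≤ 1 := by exact_mod_cast hd
            have he := Real.add_one_le_exp (-(1 / 16 * t * (torusTaxiDist x y : ℝ)))
            rw [hB, div_mul_eq_mul_div, le_div_iff₀ ht0]
            nlinarith [mul_le_mul_of_nonneg_right ht1 (Nat.cast_nonneg (torusTaxiDist x y) : (0 : ℝ) ≤ _),
              mul_le_mul_of_nonneg_right h1e hE.le]
          have hs : ∀ i, |Real.sign (hH.eigenvalues i) - 0| ≤ 1 := fun i => by
            rw [sub_zero]
            rcases Real.sign_apply_eq (hH.eigenvalues i) with h | h | h <;> rw [h] <;> norm_num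
          refine (norm_cfc_sign_apply_le hH (x, p) (y, q) (fun _ => 0) (by simp) (t := t) zero_le_one
            (fun i _ => hs i) (fun i => (hs i).trans (by norm_num))).trans ?_
          linarith
        · -- separated sites: needle of order `m`, degree `≤ 4m + 1 ≤ |x−y|₁ − 1`, killed at the entry by range one
          set m : ℕ := (torusTaxiDist x y - 2) / 4 with hm
          obtain ⟨pD, hdeg, hp1, hp2⟩ := signPolyApprox_bounded ht0 ht1 m
          have hηB : 144 / t * Real.exp (-(m * t / 4)) ≤ B := by
            have hm' : (torusTaxiDist x y : ℝ) ≤ 4 * (m : ℝ) + 5 := by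
              exact_mod_cast (show torusTaxiDist x y ≤ 4 * m + 5 by omega)
            have he : Real.exp (-(m * t / 4)) ≤ Real.exp (5 / 16) * Real.exp (-(1 / 16 * t * (torusTaxiDist x y : ℝ))) := by
              rw [← Real.exp_add, Real.exp_le_exp]
              nlinarith
            rw [hB, div_mul_eq_mul_div, div_mul_eq_mul_div]
            exact div_le_div_of_nonneg_right (by nlinarith) ht0.le
          refine (norm_cfc_sign_apply_le hH (x, p) (y, q) (fun i => pD.eval (hH.eigenvalues i)) ?_
            (by positivity) (fun i hi => hp1 _ hi (h9 i)) (fun i => hp2 _ (h9 i))).trans (by linarith)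
          refine sum_eval_eigenvalues_eq_zero hH (fun a b => torusTaxiDist a.1 b.1) (fun a => torusTaxiDist_self a.1)
            (fun a b c => torusDistOne_triangle (Ls := fun _ : Fin 4 => T) a.1 b.1 c.1)
            (fun a b hab => hW_apply_eq_zero_of_far U m₀ hab) pD ?_
          show pD.natDegree < torusTaxiDist x y
          omega
    _ = 144 * B + 2 * ∑ p : Fin 3 × Fin 4, ∑ q : Fin 3 × Fin 4,
          ∑ i ∈ Finset.univ.filter (fun i => |hH.eigenvalues i| < t),
            ‖(hH.eigenvectorBasis i) (x, p)‖ * ‖(hH.eigenvectorBasis i) (y, q)‖ := hsum _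
    _ = _ := by rw [hB]; ring

end Summit.QuantumFields.QCD.Cruxes.ExtinctionBuildsQCD.DeterminantTilt

end
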